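import Summits.AtomisticToContinuum.BoseEinsteinCondensation.Theses.BECCutLineWeakDisorder
import Summits.AtomisticToContinuum.BoseEinsteinCondensation.Theorems.BECCutLineWeakDisorderDefs
import Literature.MathematicalPhysics.QuantumManyBody.GroundStateFeynmanKacCutLine
import HarnessLib

/-!
# Crux `TwoReplicaTransienceBound` (stmt-AtomisticToContinuum-9687) — round-2 ideator 4: first lemmas

Two idea cards (`Ideas/tilt-variance-landscape-calculus.md`, `Ideas/kinetic-block-bolthausen.md`).
This file only DEFINES the objects and STATES the first lemmas as `def … : Prop` (nothing asserted,
no `sorry`); it elaborates against the route file and the landed Feynman–Kac cut-line vocabulary.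

Notation: `Φ = fkPartition v L T (x :: Y)` (unnormalised witness `e^{-TH_N}1`; every ratio below is
0-homogeneous, so the normaliser `fkNormSq` never enters), `m(Y) = ∫ₓ Φ²`, `s(Y) = ∫ₓ Φ`,
`PR(Y) = L³ m / s²` (the crux integrand, slice by slice).
-/

noncomputable section

namespace Summit.AtomisticToContinuum.BoseEinsteinCondensation.Cruxes.TwoReplicaTransienceBound.Ideator4

open MeasureTheory Filter Set
open scoped ENNReal NNReal Topology BigOperators
open Literature.MathematicalPhysics.QuantumManyBody.BoseGas
open Summit.AtomisticToContinuum.BoseEinsteinCondensation.Cruxes.TwoReplicaTransienceBound.TracerDecoupling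
  (wienerLine taggedBathAction tracer)

variable {n : ℕ}

/-! ## Card A — tilt-variance identity and coupling calculus -/

/-- The `θ`-tilted law of a nonnegative profile `φ` on the box: density `φ^θ / ∫ φ^θ` on `{φ > 0} ∩ Λ_L`
(as a real weight; `θ = 1` is the "broken"/one-sided junction law, `θ = 2` the "joined"/physical one,
`θ → 0⁺` the uniform law on the support). -/
def tiltWeight (θ : ℝ) (φ : Space → ℝ) (x : Space) : ℝ :=
  if 0 < φ x then φ x ^ θ else 0

/-- Normaliser `∫_{Λ_L} φ^θ`. -/
def tiltMass (L θ : ℝ) (φ : Space → ℝ) : ℝ :=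
  ∫ x in box L, tiltWeight θ φ x

/-- Tilted mean of `log φ`. -/
def tiltLogMean (L θ : ℝ) (φ : Space → ℝ) : ℝ :=
  (∫ x in box L, tiltWeight θ φ x * Real.log (φ x)) / tiltMass L θ φ

/-- **Tilted log-landscape variance** `Var_{x ∼ φ^θ}(log φ)`. -/
def tiltLogVariance (L θ : ℝ) (φ : Space → ℝ) : ℝ :=
  (∫ x in box L, tiltWeight θ φ x * (Real.log (φ x) - tiltLogMean L θ φ) ^ 2) / tiltMass L θ φ

/-- Lebesgue volume of the support `{φ > 0} ∩ Λ_L` (for hard cores `< L³`; equals `L³` for bounded `v`). -/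
def supportVolume (L : ℝ) (φ : Space → ℝ) : ℝ :=
  (volume ({x | 0 < φ x} ∩ box L)).toReal

/-- FIRST LEMMA of card A (**tilt-variance identity**, pure real analysis): for a bounded measurable
`φ ≥ 0` on `Λ_L` with `0 < ∫ φ` and `log φ` square-integrable against `φ^θ dx` for `θ ∈ (0, 2]`,
`log( |{φ>0}| · ∫φ² / (∫φ)² ) = ∫₀² (1 − |θ − 1|) · Var_{x∼φ^θ}(log φ) dθ`
(second difference at `0, 1, 2` of the convex `θ ↦ log ∫ φ^θ`, whose second derivative is the tilted
variance; checked numerically on `sin`, holed and spiky profiles, `toy/theta_identity.py`). Applied to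
`φ = Φ_T(·, Y)`: `PR(Y) = (L³/|{Φ>0}|) · exp(hat-average of tilted log-variances)`. -/
def TiltVarianceIdentity : Prop :=
  ∀ (L : ℝ), 0 < L → ∀ (φ : Space → ℝ), Measurable φ → (∀ x, 0 ≤ φ x) → (∃ K, ∀ x, φ x ≤ K) →
    (∀ x, x ∉ box L → φ x = 0) → 0 < ∫ x in box L, φ x →
    (∀ θ : ℝ, 0 < θ → θ ≤ 2 →
      Integrable (fun x => tiltWeight θ φ x * Real.log (φ x) ^ 2) (volume.restrict (box L))) →
    Real.log (supportVolume L φ * (∫ x in box L, φ x ^ 2) / (∫ x in box L, φ x) ^ 2) =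
      ∫ θ in Set.Ioo (0 : ℝ) 2, (1 - |θ - 1|) * tiltLogVariance L θ φ

/-- The tracer with tagged–bath coupling scaled by `λ ≥ 0`:
`E_{ω₀}[𝟙{tagged survives} · exp(−λ ∫₀ᵀ ∑ⱼ v(|B⁰ − Bʲ|))]` (at `λ = 1` this is `tracer`). -/
def tracerAt (lam : ℝ≥0) (v : ℝ → ℝ≥0∞) (L T : ℝ) (x : Space) (Y : Config n)
    (ωb : PathSpace n) : ℝ≥0∞ :=
  ∫⁻ ω₀, (survives (N := 1) L T (fun _ => x)).indicator (fun _ => (1 : ℝ≥0∞)) (fun _ => ω₀) *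
      expNeg ((lam : ℝ≥0∞) * taggedBathAction v T x Y ω₀ ωb) ∂wienerLine

/-- The coupled partition function `Φ^λ_T(x, Y) = (e^{-TH_λ}1)(x::Y)`, `H_λ` = bath Hamiltonian `+ (−Δₓ)
+ λ ∑ⱼ v(x − yⱼ)`: bath weight times `tracerAt λ`, integrated over bath paths
(`Φ¹ = fkPartition v L T (x::Y)` by the landed `stub_factorisation`; `Φ⁰ = θ_T(x) · Z_n(Y)`). -/
def coupledPartition (lam : ℝ≥0) (v : ℝ → ℝ≥0∞) (L T : ℝ) (x : Space) (Y : Config n) : ℝ≥0∞ :=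
  ∫⁻ ωb, fkWeight v L T Y ωb * tracerAt lam v L T x Y ωb ∂wienerPaths n

/-- **Expected one-sided tagged action** `a_λ(x, Y) = E^λ_{x,Y}[A]`, `A = ∫₀ᵀ∑ⱼ v(|B⁰_t − Bʲ_t|)dt`,
under the one-sided law tilted by `e^{−λA}` (numerator / `Φ^λ`; junk `0/0 = 0`). -/
def expectedAction (lam : ℝ≥0) (v : ℝ → ℝ≥0∞) (L T : ℝ) (x : Space) (Y : Config n) : ℝ≥0∞ :=
  (∫⁻ ωb, fkWeight v L T Y ωb *
      ∫⁻ ω₀, (survives (N := 1) L T (fun _ => x)).indicator (fun _ => (1 : ℝ≥0∞)) (fun _ => ω₀) *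
        expNeg ((lam : ℝ≥0∞) * taggedBathAction v T x Y ω₀ ωb) *
          taggedBathAction v T x Y ω₀ ωb ∂wienerLine ∂wienerPaths n) /
    coupledPartition lam v L T x Y

/-- Slice participation ratio of the coupled profile, `PR_λ(Y) = L³ ∫ₓ (Φ^λ)² / (∫ₓ Φ^λ)²`. -/
def coupledPR (lam : ℝ≥0) (v : ℝ → ℝ≥0∞) (L T : ℝ) (Y : Config n) : ℝ≥0∞ :=
  ENNReal.ofReal (L ^ 3) * (∫⁻ x, coupledPartition lam v L T x Y ^ 2) /
    (∫⁻ x, coupledPartition lam v L T x Y) ^ 2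

/-- Mean of `a_λ` over the junction point under the weight `(Φ^λ)^k dx` (`k = 1` broken, `k = 2` joined). -/
def junctionMean (k : ℕ) (lam : ℝ≥0) (v : ℝ → ℝ≥0∞) (L T : ℝ) (Y : Config n) : ℝ≥0∞ :=
  (∫⁻ x, coupledPartition lam v L T x Y ^ k * expectedAction lam v L T x Y) /
    ∫⁻ x, coupledPartition lam v L T x Y ^ k

/-- SECOND LEMMA of card A (**coupling formula for the log participation ratio**; bounded `v`, so that
`A < ∞` a.s. and every quantity is finite): for every slice `Y` in the box and `T ≥ 0`,
`log PR₁(Y) − log PR₀(Y) = 2 ∫₀¹ (⟨a_λ⟩_{Φ_λ dx} − ⟨a_λ⟩_{Φ_λ² dx}) dλ`,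
i.e. `∂_λ log Φ^λ = −a_λ`, `∂_λ log ∫(Φ^λ)^k = −k⟨a_λ⟩_{(Φ^λ)^k}` (dominated convergence: `A e^{−λA} ≤ A`,
`E[A] ≤ nT‖v‖_∞`), and `PR₀ = L³∫θ_T²/(∫θ_T)²` is the FREE Dirichlet profile's value (`≤ (π²/8)³`, landed). -/
def ParticipationCouplingFormula : Prop :=
  ∀ (n : ℕ) (v : ℝ → ℝ≥0∞), Measurable v → (∃ C : ℝ≥0, ∀ r, v r ≤ C) →
    ∀ (L T : ℝ), 0 < L → 0 ≤ T → ∀ Y : Config n, Y ∈ boxN n L →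
      Real.log (coupledPR 1 v L T Y).toReal - Real.log (coupledPR 0 v L T Y).toReal =
        2 * ∫ lam in Set.Ioo (0 : ℝ) 1,
          ((junctionMean 1 lam.toNNReal v L T Y).toReal - (junctionMean 2 lam.toNNReal v L T Y).toReal)

/-! ## Card B — kinetic-scale block factorisation -/

/-- The cube of the `M³`-tiling of `Λ_L` with multi-index `k`: `∏ₐ [kₐ L/M, (kₐ+1) L/M)` (half-open, so the
cubes partition `[0,L)³ ⊇ Λ_L`). -/
def cube (L : ℝ) (M : ℕ) (k : Fin 3 → Fin M) : Set Space :=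
  {x | ∀ a, x a ∈ Set.Ico ((k a : ℝ) * L / M) (((k a : ℝ) + 1) * L / M)}

/-- Block mass `a_k(Y) = ∫_{cube k} Φ_T(x, Y) dx` of the cut-line endpoint weight. -/
def blockMass (v : ℝ → ℝ≥0∞) (L T : ℝ) (M : ℕ) (Y : Config n) (k : Fin 3 → Fin M) : ℝ≥0∞ :=
  ∫⁻ x in cube L M k, fkPartition v L T (Matrix.vecCons x Y)

/-- Block second moment `m_k(Y) = ∫_{cube k} Φ_T(x, Y)² dx`. -/
def blockMoment (v : ℝ → ℝ≥0∞) (L T : ℝ) (M : ℕ) (Y : Config n) (k : Fin 3 → Fin M) : ℝ≥0∞ :=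
  ∫⁻ x in cube L M k, fkPartition v L T (Matrix.vecCons x Y) ^ 2

/-- **Across-block (infrared) participation** `R_IR(Y) = M³ ∑ₖ a_k² / (∑ₖ a_k)²` — the participation ratio of
the COARSE-GRAINED endpoint law on the block lattice `(Fin 3 → Fin M)`. -/
def acrossBlockPR (v : ℝ → ℝ≥0∞) (L T : ℝ) (M : ℕ) (Y : Config n) : ℝ≥0∞ :=
  ((M : ℝ≥0∞) ^ 3 * ∑ k : Fin 3 → Fin M, blockMass v L T M Y k ^ 2) /
    (∑ k : Fin 3 → Fin M, blockMass v L T M Y k) ^ 2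

/-- **Within-block (ultraviolet) participation** `r̄(Y) = (L/M)³ ∑ₖ m_k / ∑ₖ a_k²`
(the `a_k²`-weighted mean of the block participations `r_k = ℓ³ m_k / a_k²`, `ℓ = L/M`). -/
def withinBlockPR (v : ℝ → ℝ≥0∞) (L T : ℝ) (M : ℕ) (Y : Config n) : ℝ≥0∞ :=
  (ENNReal.ofReal ((L / M) ^ 3) * ∑ k : Fin 3 → Fin M, blockMoment v L T M Y k) /
    ∑ k : Fin 3 → Fin M, blockMass v L T M Y k ^ 2

/-- FIRST LEMMA of card B (**exact block factorisation** `PR = R_IR · r̄`): for measurable `v`, `L > 0`,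
`T ≥ 0`, `M ≥ 1` and a slice `Y` with `0 < s(Y)` (and `s(Y) < ∞`, automatic: `Φ ≤ 1` on a bounded box),
`L³ m(Y)/s(Y)² = R_IR(Y) · r̄(Y)` — because the cubes partition the support of `Φ(·,Y) ⊆ Λ_L`, so
`∑ a_k = s`, `∑ m_k = m`, and `M³ (L/M)³ = L³`. Consequences used by the card: `1 ≤ r̄` (Cauchy–Schwarz in
each cube) hence `R_IR ≤ PR ≤ R_IR · r̄`, and Hölder `E_Q[PR] ≤ ‖R_IR‖_{L^p(Q)} ‖r̄‖_{L^q(Q)}`. -/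
def BlockFactorisation : Prop :=
  ∀ (n : ℕ) (v : ℝ → ℝ≥0∞), Measurable v → ∀ (L T : ℝ), 0 < L → 0 ≤ T → ∀ (M : ℕ), 1 ≤ M →
    ∀ Y : Config n, (∫⁻ x, fkPartition v L T (Matrix.vecCons x Y)) ≠ 0 →
      ENNReal.ofReal (L ^ 3) * (∫⁻ x, fkPartition v L T (Matrix.vecCons x Y) ^ 2) /
          (∫⁻ x, fkPartition v L T (Matrix.vecCons x Y)) ^ 2 =
        acrossBlockPR v L T M Y * withinBlockPR v L T M Y

/-- The crux's averaging measure in block form: `E_Q[F] = ∫ m(Y) F(Y) dY / ∫ m` with `m(Y) = ∫ₓ Φ²`. -/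
def sliceAverage (v : ℝ → ℝ≥0∞) (L T : ℝ) (F : Config n → ℝ≥0∞) : ℝ≥0∞ :=
  (∫⁻ Y : Config n, (∫⁻ x, fkPartition v L T (Matrix.vecCons x Y) ^ 2) * F Y) /
    ∫⁻ Y : Config n, ∫⁻ x, fkPartition v L T (Matrix.vecCons x Y) ^ 2

/-- SECOND LEMMA of card B (**within-block participation at the kinetic scale, ALL polymer lengths**;
the UV module): for every admissible `v` there are `κ, ρ₁, C₁ > 0` such that for `0 < ρ < ρ₁`,
eventually in `n`, for EVERY `T ≥ 0` and the tiling with `M = ⌈L/ℓ⌉` cubes per side, `ℓ = √(κ/ρ)`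
(the kinetic length), `E_Q[r̄²] ≤ C₁`. Mechanism: Markov property of the `(n+1)`-line system at time
`s = ℓ² = κ/ρ` (`lintegral_fkWeight_mul_mul`) writes `Φ_T(·,Y)` as a mixture of the short-time kernels;
`mixture_participation_le` (landed) bounds each cube's participation by the worst kernel's; the kernel's
within-cube flatness over the short window `[0, κ/ρ]` is the landed kinetic-window technology
(`stub_kineticWindow` / `stub_sliceFlatBounded`: sausage/capacity estimates, recursion), now applied
locally in `x` at scale `ℓ` instead of globally in `T`. -/
def WithinBlockParticipation : Prop :=
  ∀ v : ℝ → ℝ≥0∞, IsRepulsiveFiniteRange v → ∃ κ : ℝ, 0 < κ ∧ ∃ ρ₁ : ℝ, 0 < ρ₁ ∧ ∃ C₁ : ℝ, 0 < C₁ ∧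
    ∀ ρ : ℝ, 0 < ρ → ρ < ρ₁ → ∀ᶠ n : ℕ in Filter.atTop, ∀ T : ℝ, 0 ≤ T →
      sliceAverage (n := n) v (sideLength ρ (n + 1)) T
          (fun Y => withinBlockPR v (sideLength ρ (n + 1)) T
            (Nat.ceil (sideLength ρ (n + 1) / Real.sqrt (κ / ρ))) Y ^ 2) ≤ ENNReal.ofReal C₁

/-- The IR module of card B as a TRANSFER target (informal hypotheses named in the card; typed shape only):
the across-block participation of the coarse-grained endpoint law has a bounded second `Q`-moment,
uniformly in the polymer length, eventually in `n`. With `BlockFactorisation`, `WithinBlockParticipation`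
and Cauchy–Schwarz in `Q` this gives the crux (`E_Q[PR] ≤ (E_Q R_IR²)^{1/2} (E_Q r̄²)^{1/2}`). -/
def AcrossBlockSecondMoment : Prop :=
  ∀ v : ℝ → ℝ≥0∞, IsRepulsiveFiniteRange v → ∀ κ : ℝ, 0 < κ → ∃ ρ₀ : ℝ, 0 < ρ₀ ∧
    ∀ ρ : ℝ, 0 < ρ → ρ < ρ₀ → ∃ C₂ : ℝ, 0 < C₂ ∧ ∀ᶠ n : ℕ in Filter.atTop, ∀ T : ℝ, 0 ≤ T →
      sliceAverage (n := n) v (sideLength ρ (n + 1)) T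
          (fun Y => acrossBlockPR v (sideLength ρ (n + 1)) T
            (Nat.ceil (sideLength ρ (n + 1) / Real.sqrt (κ / ρ))) Y ^ 2) ≤ ENNReal.ofReal C₂

/-- The composition the card proposes (bookkeeping over the two lemmas + Cauchy–Schwarz in `Q`;
stated, to be proved in a crux-plan skeleton, not here). -/
def BlockComposition : Prop :=
  BlockFactorisation → WithinBlockParticipation → AcrossBlockSecondMoment →
    Summit.AtomisticToContinuum.BoseEinsteinCondensation.Theses.BECCutLineWeakDisorder.TwoReplicaTransienceBound


/-! ## Card C — across-cut thinning (GHS-type) domination of the annealed connected functional -/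

/-- The ANNEALED two-sided bath functional with a past tube (strength `s`, frozen tagged path `ω₀`, read
forward from the slice by time-reversal symmetry) and a future tube (strength `t`, frozen tagged path `ω₀'`),
both emanating from the junction `x`: `Λ(s,t) = ∫_Y (E_Y[w·e^{-sA(ω₀)}]) (E_Y[w·e^{-tA(ω₀')}]) dY`
(`A` = `taggedBathAction`, the bath's occupation of the tube painted by the frozen tagged path; past and
future baths are independent given the slice `Y`, `lintegral_mul_lintegral_fkWeight_two_mul`). -/
def twoSidedCross (s t : ℝ≥0) (v : ℝ → ℝ≥0∞) (L T : ℝ) (x : Space)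
    (ω₀ ω₀' : Fin 3 → (ℝ≥0 → ℝ)) : ℝ≥0∞ :=
  ∫⁻ Y in boxN n L,
    (∫⁻ ωb, fkWeight v L T Y ωb * expNeg ((s : ℝ≥0∞) * taggedBathAction v T x Y ω₀ ωb) ∂wienerPaths n) *
      (∫⁻ ωb, fkWeight v L T Y ωb * expNeg ((t : ℝ≥0∞) * taggedBathAction v T x Y ω₀' ωb) ∂wienerPaths n)

/-- Mixed first moment `∫_Y E_Y[w·A(ω₀)^i] E_Y[w·A(ω₀')^j] dY` under the UNTILTED two-sided law
(`i, j ∈ {0,1}`; `(0,0)` is `Λ(0,0)`). -/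
def crossMoment (i j : ℕ) (v : ℝ → ℝ≥0∞) (L T : ℝ) (x : Space)
    (ω₀ ω₀' : Fin 3 → (ℝ≥0 → ℝ)) : ℝ≥0∞ :=
  ∫⁻ Y in boxN n L,
    (∫⁻ ωb, fkWeight v L T Y ωb * taggedBathAction v T x Y ω₀ ωb ^ i ∂wienerPaths n) *
      (∫⁻ ωb, fkWeight v L T Y ωb * taggedBathAction v T x Y ω₀' ωb ^ j ∂wienerPaths n)

/-- The positive part of the UNTILTED across-cut covariance `C₀ = Cov₀(A_past, A_fut)` (the Gaussian /
second-order value of the connected cross term), in `[0,∞]` through truncated subtraction: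
`C₀⁺ = (Λ₀₀·E[AA'] − E[A]·E[A'])⁺ / Λ₀₀²`. -/
def gaussianCrossPos (v : ℝ → ℝ≥0∞) (L T : ℝ) (x : Space) (ω₀ ω₀' : Fin 3 → (ℝ≥0 → ℝ)) : ℝ≥0∞ :=
  (crossMoment (n := n) 0 0 v L T x ω₀ ω₀' * crossMoment (n := n) 1 1 v L T x ω₀ ω₀' -
      crossMoment (n := n) 1 0 v L T x ω₀ ω₀' * crossMoment (n := n) 0 1 v L T x ω₀ ω₀') /
    crossMoment (n := n) 0 0 v L T x ω₀ ω₀' ^ 2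

/-- `e^{c}` on `[0,∞]` (`e^{∞} = ∞`). -/
def expPos (c : ℝ≥0∞) : ℝ≥0∞ := if c = ∞ then ∞ else ENNReal.ofReal (Real.exp c.toReal)

/-- FIRST LEMMA / TARGET of card C (**across-cut thinning domination**, the correlation-inequality target of
TRIAGE-r1-3 (b) in corrected form): for bounded measurable `v`, every box, polymer length, junction `x` and
every pair of frozen tagged paths, the connected across-cut functional is dominated by the POSITIVE PART of its
second-order (untilted-covariance) value with constant `K = 1`:
`Λ(1,1)·Λ(0,0) ≤ Λ(1,0)·Λ(0,1)·exp(C₀⁺)`.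
Mechanism: `∂ₛ∂ₜ log Λ(s,t) = Cov_{s,t}(A,A')` shrinks toward `0` under the repulsive tilts (thinning; exact in the
Poisson limit, where `∂ₛ∂ₜ log Λ = ρ∫E[AA'e^{-sA-tA'}]`), so `log Λ(1,1) − log Λ(1,0) − log Λ(0,1) + log Λ(0,0)
= ∫₀¹∫₀¹ Cov_{s,t} ≤ C₀⁺`. Toy evidence kit j020716 (1-D lattice Bose bath ED, 48 cases): `K = X/C₀ ∈ [0.58, 0.92]`
in all 36 cases with `|C₀|` non-negligible, monotone thinning in 24/24 joined-geometry cases. -/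
def AcrossCutThinning : Prop :=
  ∀ (n : ℕ) (v : ℝ → ℝ≥0∞), Measurable v → (∃ C : ℝ≥0, ∀ r, v r ≤ C) → ∀ (L T : ℝ), 0 < L → 0 ≤ T →
    ∀ (x : Space) (ω₀ ω₀' : Fin 3 → (ℝ≥0 → ℝ)),
      twoSidedCross (n := n) 1 1 v L T x ω₀ ω₀' * twoSidedCross (n := n) 0 0 v L T x ω₀ ω₀' ≤
        twoSidedCross (n := n) 1 0 v L T x ω₀ ω₀' * twoSidedCross (n := n) 0 1 v L T x ω₀ ω₀' *
          expPos (gaussianCrossPos (n := n) v L T x ω₀ ω₀')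

end Summit.AtomisticToContinuum.BoseEinsteinCondensation.Cruxes.TwoReplicaTransienceBound.Ideator4

end
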